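import Mathlib
import Summits.HodgeConjecture.FermatCycles.HodgeFermatSevenThree

/-!
# THEOREM L at `p = 7`, quotient 5 — the rows (U, Z1) and (Z1, Z1) completed (`HodgeFermat/SevenFive.lean`; HF-G29e)

Tree copy (whole module) of the module `HodgeFermat/SevenFive.lean` of the sibling cell's standalone package
`run/shared/lean/pub/pub-hodgefermat/lean/HodgeFermat/` (358 lines, sha256 `cf136ece5bbba080…`), source lines 58–358 (all: THEOREM L at `p = 7`, quotient 5 — `uz1_seven`, `z1z1_seven`).
Filed by cell `pub-hfermat`, seat prover-1 gen-3, on the COORDINATOR KEEPER RULING of 2026-08-25 (gem sweep H1: take the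
off-gate kernel theorem `thmFstar` through the gate) — here THEOREM F* of `tables/DPRIME-THEOREM.md` §9 IN FULL, i.e.
PROPOSITION D′(3N) and the descent (`HodgeFermat/PropDPrimeNFinal.lean`, GATE HF-G34), the last off-gate form of THEOREM F*
(its first two forms, `DecodingFinal.thmFstar` = F* at the prime levels and `ThmFstarNFinal.thmFstar` = F*(3N), landed on
2026-08-25 as `HodgeFermatThmFstar.lean` / `HodgeFermatThmFstarN.lean`, seats prover-1 gen-0 / gen-2); this file is one link of
the import closure of `PropDPrimeNFinal.propDprime` (the sibling's KR-free chain: THEOREM L, COROLLARY M, THEOREM D6,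
THEOREM U⁺, THEOREM KR6, THEOREM Z3U) on top of those landed chains.  The source module is the sibling's hub-checked module of
record (pub-hodgefermat `CERT.md` l.942, GATE HF-G29e); its declarations are copied VERBATIM.
Deviations from the source module, exhaustively: the `import` lines (tree modules `Summits.HodgeConjecture.FermatCycles.
HodgeFermat*` instead of `HodgeFermat.*`); this module docstring; none besides these.
Every other line — in particular every declaration's statement and proof — is byte-identical to the source.
HONEST FRAMING: explicit algebraic cycles for specific Hodge classes on Fermat/Delsarte varieties; residual open instances
listed; no claim on general Hodge.  (This file is arithmetic of CM types / finite combinatorics / analytic number theory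
of the sibling's KR-free programme; it claims nothing about cycles.)

The source module's docstring (SevenFive.lean l.3–56), verbatim:

## THEOREM L at `p = 7`, quotient 5 — the rows (U, Z1) and (Z1, Z1) COMPLETED by bookkeeping along `1, 7, 49, 343`
## (`tables/DPRIME-THEOREM.md` §3: PROPOSITION L7 (a), branch n′ = 5, and the residual (Z1, Z1) case "left open" there;
## `tables/KR-FREE.md` §3: PROPOSITION L7 (c) — now for EVERY level; build hodge-fermat, generation 29, addendum HF-G29e)

Setting as in `SevenThree.lean`: level `7n`, `7 ∤ n`; `T = (7y, x₂, x₃)` of pattern Z1 at 7; `T′` a unit triple `(x′, y′, z′)`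
(pattern U) or another Z1 triple `(7y′, x₂′, x₃′)`; `R = rsum_n(T, ·)`, `R′ = rsum_n(T′, ·)`, `K(t) = ⌊7⟨ty⟩_n/n⌋`.
`SevenThree.lean` left, for odd `n`, exactly the QUOTIENT-5 cases: `n = 5·gcd(y, n)` in row (U, Z1) and `n = 5·gcd(y − y′, n)`
in row (Z1, Z1).  By hand (DPRIME §3) the first is the n′ = 5 branch of PROPOSITION L7 (a) (a coincidence analysis ending in
F5, F15a, F35, F105, for `n` squarefree and the pair jointly primitive) and the second is the bracket "slack on {s ∈ {1, 4}} —
left open", closed only at the levels prime to 6 by PROPOSITION L7 (c) of `KR-FREE.md` (LEMMA CC, a conductor-5 character, + F35).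
THIS FILE closes BOTH for EVERY `n` — no parity, squarefreeness or joint primitivity, no certificate, no DESCENT, no character —
by the same bookkeeping as `SevenThree.lean`, now CHAINED along three consecutive pairs `(7, 1), (49, 7), (343, 49)`:

* With `n = 5g`: `⟨ty⟩_n = g·s(t)`, `s ∈ {1, 2, 3, 4}` [`val_cases_q5`], and `s(7t) ≡ 2s(t) (mod 5)` [`val_mul7`]: along
  `7, 49, 343` the class `s` runs through `s₁, 2s₁, 4s₁ (mod 5)` and the digit `K = ⌊7s/5⌋ = 1, 2, 4, 5` for `s = 1, 2, 3, 4`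
  [`digit_eq`] is known at each point.
* Row (U, Z1) [`uz1_seven_five`]: (E), Z1–U at the pair `(7^(k+1), 7^k)` reads `n·(K_k − 3) = [R_k − R_(k+1)] + [R′_(k+1) − R′_k]`
  (`R_k = R(7^k)`); with `K_k − 3 ∈ {−2, −1, +1, +2}` determined by the class, and `|R_i − R_j|, |R′_i − R′_j| ≤ n`
  [`TheoremL.delta_le`] for `i, j ∈ {1, 7, 49, 343}`, the three equations are inconsistent for each of the four starting
  classes `s₁` (a `±2` step pins two differences to `±n`, and the neighbouring `±1`/`±2` step then cannot be paid for).
  By hand this is the s-cycle `1 → 3 → 4 → 2` of PROPOSITION L7 (a), n′ = 5, read along ONE orbit instead of class by class.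
* Row (Z1, Z1) [`pointwise_z1z1_five`, `z1z1_seven_five`]: with `z = y − y′` (as `y + (n−1)y′`), `n = 5·gcd(z, n)`,
  `⟨t₀z⟩_n = g·s`: (E), Z1–Z1 gives `n(K − K′)(t₀) = [R′(t₀) − R′(t₁)] + [R(t₁) − R(t₀)]` and the floor bookkeeping
  [`SevenThree.floor_shift`] gives `K − K′ ≥ 1, = 2, = −2, ≤ −1` for `s = 1, 2, 3, 4`; so `s = 2, 3` pin both differences to `±n`
  and `s = 1, 4` give a one-sided inequality — the hand proof's "slack".  Chained along `(7, 1), (49, 7), (343, 49)` (classes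
  `s₁, 2s₁, 4s₁`), the slack is absorbed: for every `s₁` the three constraints contradict `delta_le`.
CONSEQUENCES, with `SevenThree.row_UZ1_seven` / `row_Z1Z1_seven` (THEOREM L's bounds + parity + quotient 3):
[`uz1_seven`] for every ODD `n` with `7 ∤ n`, NO triple `(7y, x₂, x₃)` of pattern Z1 at 7 with `7y ≢ 0 (mod 7n)` has the CM
type of a unit triple — THEOREM L's row (U, Z1) at `p = 7` is "impossible", exactly as for `p ≥ 11`, and PROPOSITION L7 (a)
holds at every odd level, squarefree or not, with no joint primitivity; [`z1z1_seven`] for every odd `n` with `7 ∤ n`, two Z1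
triples `(7y, x₂, x₃)`, `(7y′, x₂′, x₃′)` of the same CM type have `y ≡ y′ (mod n)`, i.e. `7y ≡ 7y′ (mod 7n)` — THEOREM L's row
(Z1, Z1) at `p = 7` is "`py ≡ py′`", exactly as for `p ≥ 11`; PROPOSITION L7 (b), (c) hold at EVERY level (the case left open
in DPRIME §3 at `3 ∣ n` does not occur).  So at `p = 7` THEOREM L's table coincides with its `p ≥ 11` rows, in the kernel.

EARLIER KERNEL FORMS SUPERSEDED: generation 22's `PropL7a.row_UZ1_seven_not3` (row (U, Z1), n′ = 5: `Squarefree n`, `3 ∤ n`, joint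
primitivity, and the kernel-decided certificate F35 = `CoincidenceFree 35`) and `PropL7c.propL7c` (row (Z1, Z1): `Squarefree n`, `3 ∤ n`,
joint primitivity, disjointness; LEMMA CC) — `uz1_seven` / `z1z1_seven` keep only `Odd n`, `7 ∤ n` (and `n ∤ y` resp. nothing), and
use no certificate.  `Odd n` cannot be dropped: at even `n` the scan below finds (U, Z1) pairs with quotient 2 and 4 (none with 3, 5).

Imports `HodgeFermat.SevenThree` (hence `LemmaN`, `LemmaO`, `TheoremLRows`, `TheoremL13`); uses `LemmaN.fibre_identity_Z1U`,
`fibre_identity_Z1Z1`, `LemmaO.lemmaO_mem`, `TheoremL.delta_le`, `dvd_of_level`, `SevenThree.floor_shift`, `row_UZ1_seven`,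
`row_Z1Z1_seven`.  `set_option autoImplicit false`; no `sorry`, no `decide`, no `native_decide`; axioms of every theorem = [propext,
Classical.choice, Quot.sound]; hub `lean check` of the 6-body record `check/SevenFive_standalone.lean` (LemmaN, LemmaO, TheoremLRows,
TheoremL13, SevenThree, SevenFive under one `import Mathlib`): rc 0, 0 errors, 0 warnings, ≈ 15 s
(results/gen29/local/lean/SevenFive_standalone.check.json; planted controls LH/LI/LJ rc 1).  Independent cross-check:
`code/gen29/seven5_scan.py` (pure Python, first principles: CM type = the set of units `t` with `⟨ta⟩ + ⟨tb⟩ + ⟨tc⟩ = 7n`) finds, at the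
26 levels `7n ≤ 1155` with `5 ∣ n`, `7 ∤ n` scanned (`n = 5, 10, 15, …, 125, 135, 145, 155, 165`: every such `n ≤ 125` — odd AND even,
squarefree or not — plus `135, 145, 155, 165`), NO (U, Z1) or (Z1, Z1) coincidence with quotient 5 (claims (i), (ii)) or 3, NO (U, Z1)
coincidence at all at the 15 odd `n` (claim (iii) = `uz1_seven`) and only quotient-1 (Z1, Z1) coincidences at odd `n` (claim (iv) =
`z1z1_seven`; in fact none), while at the 11 even `n` it does find 6960 + 216 (U, Z1) pairs with quotient 2, 4 and 240 (Z1, Z1) pairs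
with quotient 1, and its detector fires on 18788 (Z3, ·) control coincidences — results/gen29/local/seven5_scan_1155.txt, verdict
`SEVEN5-SCAN GREEN`, 198 s.
-/

set_option autoImplicit false

namespace HodgeFermat.KRFree.SevenFive

open HodgeFermat.KRFree.LemmaN HodgeFermat.KRFree.LemmaO HodgeFermat.KRFree.TheoremL HodgeFermat.KRFree.SevenThree

/-! ## 0. Residues and digits at quotient 5 -/

/-- for a unit `t` and `n = 5g`, `g = gcd(y, n)`: `⟨ty⟩_n = g·s` with `s ∈ {1, 2, 3, 4}` (LEMMA O) -/
lemma val_cases_q5 (n y t : ℕ) (hn : 0 < n) (hn5 : n = 5 * Nat.gcd y n) (ht : Nat.Coprime t n) :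
    ∃ s, (s = 1 ∨ s = 2 ∨ s = 3 ∨ s = 4) ∧ t * y % n = Nat.gcd y n * s := by
  obtain ⟨s, hs, hsc, hv⟩ := lemmaO_mem n y t hn ht
  have hg0 : 0 < Nat.gcd y n := Nat.gcd_pos_of_pos_right _ hn
  have hq : n / Nat.gcd y n = 5 := Nat.div_eq_of_eq_mul_right hg0 (by omega)
  rw [hq] at hs hsc
  refine ⟨s, ?_, hv⟩
  interval_cases s
  · simp at hsc
  all_goals omega

/-- one step `t ↦ 7t`: if `⟨ty⟩_n = r` and `7r = n·q + r′` with `r′ < n`, then `⟨7t·y⟩_n = r′` -/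
lemma val_mul7 {n y t t' r q r' : ℕ} (ht' : t' = 7 * t) (hv : t * y % n = r) (hr : 7 * r = n * q + r')
    (hr' : r' < n) : t' * y % n = r' := by
  subst ht'
  obtain ⟨m, hm⟩ : ∃ m, t * y / n = m := ⟨_, rfl⟩
  have hdm := Nat.div_add_mod (t * y) n
  rw [hv, hm] at hdm
  have e : 7 * t * y = r' + n * (7 * m + q) := by
    zify at hdm hr ⊢
    linear_combination (-7 : ℤ) * hdm + hr
  rw [e, Nat.add_mul_mod_self_left, Nat.mod_eq_of_lt hr']

/-- the digit: `7v = r + K·n` with `r < n` ⟹ `⌊7v/n⌋ = K` -/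
lemma digit_eq {n v r K : ℕ} (hn : 0 < n) (h : 7 * v = r + K * n) (hr : r < n) : 7 * v / n = K := by
  rw [h, Nat.add_mul_div_right _ _ hn, Nat.div_eq_of_lt hr, zero_add]

/-! ## 1. Row (U, Z1) at `p = 7` with `n = 5·gcd(y, n)`: impossible (three chained steps along `1, 7, 49, 343`) -/

/-- **PROPOSITION L7 (a), branch n′ = 5, for EVERY `n`** (`7 ∤ n`; no parity, squarefreeness or joint-primitivity
hypothesis, no certificate): a triple `T = (7y, x₂, x₃)` of pattern Z1 at 7 with `n = 5·gcd(y, n)` and a triple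
`T′ = (x′, y′, z′)` of pattern U at 7 never have the same CM type at level `7n`. -/
theorem uz1_seven_five (n y x₂ x₃ x' y' z' : ℕ) (h7n : ¬ 7 ∣ n) (hn : 0 < n) (hn5 : n = 5 * Nat.gcd y n)
    (hs : 7 * n ∣ 7 * y + x₂ + x₃) (hx₂ : ¬ 7 ∣ x₂) (hx₃ : ¬ 7 ∣ x₃)
    (hs' : 7 * n ∣ x' + y' + z') (hx' : ¬ 7 ∣ x') (hy' : ¬ 7 ∣ y') (hz' : ¬ 7 ∣ z')
    (hH : SameType (7 * n) (7 * y, x₂, x₃) (x', y', z')) : False := by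
  have hp : (7).Prime := by norm_num
  have hco : Nat.Coprime 7 n := (Nat.Prime.coprime_iff_not_dvd hp).mpr h7n
  have c1 : Nat.Coprime 1 n := Nat.coprime_one_left n
  have c49 : Nat.Coprime 49 n := by simpa using Nat.Coprime.pow_left 2 hco
  have c343 : Nat.Coprime 343 n := by simpa using Nat.Coprime.pow_left 3 hco
  -- the fibre identity (E), Z1–U, at the three pairs (7, 1), (49, 7), (343, 49)
  have E : ∀ t₀ t₁ : ℕ, Nat.Coprime t₀ n → 7 * t₁ ≡ t₀ [MOD n] →
      2 * n * (7 * (t₀ * y % n) / n) + 2 * rsum n (7 * y, x₂, x₃) t₀ + 2 * rsum n (x', y', z') t₁ + n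
        = 7 * n + 2 * rsum n (7 * y, x₂, x₃) t₁ + 2 * rsum n (x', y', z') t₀ :=
    fun t₀ t₁ ht₀ ht₁ => fibre_identity_Z1U 7 n y x₂ x₃ x' y' z' t₀ t₁ hp h7n hn hs hx₂ hx₃ hs' hx' hy' hz' ht₀ ht₁ hH
  have E1 := E 7 1 hco (by norm_num [Nat.ModEq])
  have E2 := E 49 7 c49 (by norm_num [Nat.ModEq])
  have E3 := E 343 49 c343 (by norm_num [Nat.ModEq])
  -- |R_i − R_j| ≤ n, |R′_i − R′_j| ≤ n on {1, 7, 49, 343}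
  have hsn := dvd_of_level hs
  have hsn' := dvd_of_level hs'
  have d01 := delta_le n (7 * y) x₂ x₃ 1 7 hn hsn c1 hco
  have d02 := delta_le n (7 * y) x₂ x₃ 1 49 hn hsn c1 c49
  have d03 := delta_le n (7 * y) x₂ x₃ 1 343 hn hsn c1 c343
  have d12 := delta_le n (7 * y) x₂ x₃ 7 49 hn hsn hco c49
  have d13 := delta_le n (7 * y) x₂ x₃ 7 343 hn hsn hco c343
  have d23 := delta_le n (7 * y) x₂ x₃ 49 343 hn hsn c49 c343
  have d01' := delta_le n x' y' z' 1 7 hn hsn' c1 hco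
  have d02' := delta_le n x' y' z' 1 49 hn hsn' c1 c49
  have d03' := delta_le n x' y' z' 1 343 hn hsn' c1 c343
  have d12' := delta_le n x' y' z' 7 49 hn hsn' hco c49
  have d13' := delta_le n x' y' z' 7 343 hn hsn' hco c343
  have d23' := delta_le n x' y' z' 49 343 hn hsn' c49 c343
  -- the class s₁ = s(7) and the residues / digits along the chain
  obtain ⟨g, hg⟩ : ∃ g, Nat.gcd y n = g := ⟨_, rfl⟩
  have hg0 : 0 < g := hg ▸ Nat.gcd_pos_of_pos_right _ hn
  obtain ⟨s, hs4, hv1⟩ := val_cases_q5 n y 7 hn hn5 hco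
  rw [hg] at hv1 hn5
  rcases hs4 with rfl | rfl | rfl | rfl
  · -- classes 1, 2, 4 at 7, 49, 343: digits 1, 2, 5
    have hv2 := val_mul7 (show (49 : ℕ) = 7 * 7 by norm_num) hv1 (show 7 * (g * 1) = n * 1 + g * 2 by omega) (by omega)
    have hv3 := val_mul7 (show (343 : ℕ) = 7 * 49 by norm_num) hv2 (show 7 * (g * 2) = n * 2 + g * 4 by omega) (by omega)
    rw [hv1, digit_eq hn (show 7 * (g * 1) = 2 * g + 1 * n by omega) (by omega)] at E1
    rw [hv2, digit_eq hn (show 7 * (g * 2) = 4 * g + 2 * n by omega) (by omega)] at E2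
    rw [hv3, digit_eq hn (show 7 * (g * 4) = 3 * g + 5 * n by omega) (by omega)] at E3
    omega
  · -- classes 2, 4, 3: digits 2, 5, 4
    have hv2 := val_mul7 (show (49 : ℕ) = 7 * 7 by norm_num) hv1 (show 7 * (g * 2) = n * 2 + g * 4 by omega) (by omega)
    have hv3 := val_mul7 (show (343 : ℕ) = 7 * 49 by norm_num) hv2 (show 7 * (g * 4) = n * 5 + g * 3 by omega) (by omega)
    rw [hv1, digit_eq hn (show 7 * (g * 2) = 4 * g + 2 * n by omega) (by omega)] at E1
    rw [hv2, digit_eq hn (show 7 * (g * 4) = 3 * g + 5 * n by omega) (by omega)] at E2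
    rw [hv3, digit_eq hn (show 7 * (g * 3) = 1 * g + 4 * n by omega) (by omega)] at E3
    omega
  · -- classes 3, 1, 2: digits 4, 1, 2
    have hv2 := val_mul7 (show (49 : ℕ) = 7 * 7 by norm_num) hv1 (show 7 * (g * 3) = n * 4 + g * 1 by omega) (by omega)
    have hv3 := val_mul7 (show (343 : ℕ) = 7 * 49 by norm_num) hv2 (show 7 * (g * 1) = n * 1 + g * 2 by omega) (by omega)
    rw [hv1, digit_eq hn (show 7 * (g * 3) = 1 * g + 4 * n by omega) (by omega)] at E1
    rw [hv2, digit_eq hn (show 7 * (g * 1) = 2 * g + 1 * n by omega) (by omega)] at E2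
    rw [hv3, digit_eq hn (show 7 * (g * 2) = 4 * g + 2 * n by omega) (by omega)] at E3
    omega
  · -- classes 4, 3, 1: digits 5, 4, 1
    have hv2 := val_mul7 (show (49 : ℕ) = 7 * 7 by norm_num) hv1 (show 7 * (g * 4) = n * 5 + g * 3 by omega) (by omega)
    have hv3 := val_mul7 (show (343 : ℕ) = 7 * 49 by norm_num) hv2 (show 7 * (g * 3) = n * 4 + g * 1 by omega) (by omega)
    rw [hv1, digit_eq hn (show 7 * (g * 4) = 3 * g + 5 * n by omega) (by omega)] at E1
    rw [hv2, digit_eq hn (show 7 * (g * 3) = 1 * g + 4 * n by omega) (by omega)] at E2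
    rw [hv3, digit_eq hn (show 7 * (g * 1) = 2 * g + 1 * n by omega) (by omega)] at E3
    omega

/-- **THEOREM L, row (U, Z1) at p = 7 — FINAL FORM: impossible.**  For every odd `n` with `7 ∤ n` (`3 ∣ n` allowed, squarefree
or not, no joint primitivity), no triple `T = (7y, x₂, x₃)` of pattern Z1 at 7 with `7y ≢ 0 (mod 7n)` has the CM type of a unit
triple `T′ = (x′, y′, z′)`.  (PROPOSITION L7 (a) at every odd level.) -/
theorem uz1_seven (n y x₂ x₃ x' y' z' : ℕ) (h7n : ¬ 7 ∣ n) (hn : 0 < n) (hodd : Odd n)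
    (hs : 7 * n ∣ 7 * y + x₂ + x₃) (hx₂ : ¬ 7 ∣ x₂) (hx₃ : ¬ 7 ∣ x₃)
    (hs' : 7 * n ∣ x' + y' + z') (hx' : ¬ 7 ∣ x') (hy' : ¬ 7 ∣ y') (hz' : ¬ 7 ∣ z') (hy : ¬ n ∣ y)
    (hH : SameType (7 * n) (7 * y, x₂, x₃) (x', y', z')) : False :=
  uz1_seven_five n y x₂ x₃ x' y' z' h7n hn
    (SevenThree.row_UZ1_seven n y x₂ x₃ x' y' z' h7n hn hodd hs hx₂ hx₃ hs' hx' hy' hz' hy hH) hs hx₂ hx₃ hs' hx' hy' hz' hH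

/-! ## 2. Row (Z1, Z1) at `p = 7` with `n = 5·gcd(y − y′, n)`: impossible (three chained steps) -/

/-- POINTWISE (Z1/Z1) at `p = 7`, quotient 5: `z = y − y′` as `y + (n−1)y′`, `n = 5g`, `⟨t₀z⟩_n = g·s`; at a pair `(t₀, t₁)` of
units with `7t₁ ≡ t₀ (mod n)`:  `s = 1 ⟹ R(t₀) + R′(t₁) + n ≤ R(t₁) + R′(t₀)`;  `s = 2 ⟹ R(t₁) = R(t₀) + n ∧ R′(t₀) = R′(t₁) + n`;
`s = 3 ⟹ R(t₀) = R(t₁) + n ∧ R′(t₁) = R′(t₀) + n`;  `s = 4 ⟹ R(t₁) + R′(t₀) + n ≤ R(t₀) + R′(t₁)`. -/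
lemma pointwise_z1z1_five {n y x₂ x₃ y' x₂' x₃' t₀ t₁ g s : ℕ} (h7n : ¬ 7 ∣ n) (hn : 0 < n)
    (hs : 7 * n ∣ 7 * y + x₂ + x₃) (hx₂ : ¬ 7 ∣ x₂) (hx₃ : ¬ 7 ∣ x₃)
    (hs' : 7 * n ∣ 7 * y' + x₂' + x₃') (hx₂' : ¬ 7 ∣ x₂') (hx₃' : ¬ 7 ∣ x₃')
    (hH : SameType (7 * n) (7 * y, x₂, x₃) (7 * y', x₂', x₃'))
    (ht₀ : Nat.Coprime t₀ n) (ht₁u : Nat.Coprime t₁ n) (ht₁ : 7 * t₁ ≡ t₀ [MOD n])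
    (hn5 : n = 5 * g) (hsv : s = 1 ∨ s = 2 ∨ s = 3 ∨ s = 4)
    (hzv : t₀ * (y + (n - 1) * y') % n = g * s) :
    (s = 1 → rsum n (7 * y, x₂, x₃) t₀ + rsum n (7 * y', x₂', x₃') t₁ + n
              ≤ rsum n (7 * y, x₂, x₃) t₁ + rsum n (7 * y', x₂', x₃') t₀) ∧
    (s = 2 → rsum n (7 * y, x₂, x₃) t₁ = rsum n (7 * y, x₂, x₃) t₀ + n ∧
              rsum n (7 * y', x₂', x₃') t₀ = rsum n (7 * y', x₂', x₃') t₁ + n) ∧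
    (s = 3 → rsum n (7 * y, x₂, x₃) t₀ = rsum n (7 * y, x₂, x₃) t₁ + n ∧
              rsum n (7 * y', x₂', x₃') t₁ = rsum n (7 * y', x₂', x₃') t₀ + n) ∧
    (s = 4 → rsum n (7 * y, x₂, x₃) t₁ + rsum n (7 * y', x₂', x₃') t₀ + n
              ≤ rsum n (7 * y, x₂, x₃) t₀ + rsum n (7 * y', x₂', x₃') t₁) := by
  have hp : (7).Prime := by norm_num
  have hsum : y + (n - 1) * y' + y' = y + n * y' := by zify [hn]; ring
  have hE := fibre_identity_Z1Z1 7 n y x₂ x₃ y' x₂' x₃' t₀ t₁ hp h7n hn hs hx₂ hx₃ hs' hx₂' hx₃' ht₀ ht₁ hH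
  have hd := delta_le n (7 * y) x₂ x₃ t₀ t₁ hn (dvd_of_level hs) ht₀ ht₁u
  have hd' := delta_le n (7 * y') x₂' x₃' t₀ t₁ hn (dvd_of_level hs') ht₀ ht₁u
  -- g·s + ⟨t₀y′⟩ ≡ ⟨t₀y⟩ (mod n)
  have hrel : (g * s + t₀ * y' % n) % n = t₀ * y % n := by
    have h0 : (t₀ * (y + (n - 1) * y') % n + t₀ * y' % n) % n = t₀ * y % n := by
      rw [← Nat.add_mod, ← Nat.mul_add, hsum, Nat.mul_add, ← mul_assoc, mul_comm t₀ n, mul_assoc,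
        Nat.add_mul_mod_self_left]
    rwa [hzv] at h0
  obtain ⟨v, hv⟩ : ∃ v, t₀ * y % n = v := ⟨_, rfl⟩
  obtain ⟨v', hv'⟩ : ∃ v', t₀ * y' % n = v' := ⟨_, rfl⟩
  have hvn : v < n := hv ▸ Nat.mod_lt _ hn
  have hvn' : v' < n := hv' ▸ Nat.mod_lt _ hn
  rw [hv, hv'] at hrel
  rw [hv, hv'] at hE
  have hgs : g * s < n := by rcases hsv with rfl | rfl | rfl | rfl <;> omega
  have hq := Nat.div_add_mod (g * s + v') n
  rw [hrel] at hq
  have hq2 : (g * s + v') / n < 2 := Nat.div_lt_of_lt_mul (by omega)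
  obtain ⟨q, hqd⟩ : ∃ q, (g * s + v') / n = q := ⟨_, rfl⟩
  rw [hqd] at hq hq2
  obtain ⟨k, hk⟩ : ∃ k, 7 * v / n = k := ⟨_, rfl⟩
  obtain ⟨k', hk'⟩ : ∃ k', 7 * v' / n = k' := ⟨_, rfl⟩
  rw [hk, hk'] at hE
  rcases hsv with rfl | rfl | rfl | rfl <;> interval_cases q
  · -- s = 1, v = v′ + g: K ≥ K′ + 1
    have f := floor_shift (c := 1) hn (show 7 * v = 7 * v' + 2 * g + 1 * n by omega)
    rw [hk, hk'] at f
    have f' := Nat.mul_le_mul_left n f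
    have e' : n * (k' + 1) = n * k' + 1 * n := by ring
    refine ⟨?_, ?_, ?_, ?_⟩ <;> intro h <;> omega
  · -- s = 1, v′ = v + 4g: K′ ≥ K + 5, impossible
    have f := floor_shift (c := 5) hn (show 7 * v' = 7 * v + 3 * g + 5 * n by omega)
    rw [hk, hk'] at f
    have f' := Nat.mul_le_mul_left n f
    have e' : n * (k + 5) = n * k + 5 * n := by ring
    refine ⟨?_, ?_, ?_, ?_⟩ <;> intro h <;> omega
  · -- s = 2, v = v′ + 2g: K ≥ K′ + 2
    have f := floor_shift (c := 2) hn (show 7 * v = 7 * v' + 4 * g + 2 * n by omega)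
    rw [hk, hk'] at f
    have f' := Nat.mul_le_mul_left n f
    have e' : n * (k' + 2) = n * k' + 2 * n := by ring
    refine ⟨?_, ?_, ?_, ?_⟩ <;> intro h <;> omega
  · -- s = 2, v′ = v + 3g: K′ ≥ K + 4, impossible
    have f := floor_shift (c := 4) hn (show 7 * v' = 7 * v + 1 * g + 4 * n by omega)
    rw [hk, hk'] at f
    have f' := Nat.mul_le_mul_left n f
    have e' : n * (k + 4) = n * k + 4 * n := by ring
    refine ⟨?_, ?_, ?_, ?_⟩ <;> intro h <;> omega
  · -- s = 3, v = v′ + 3g: K ≥ K′ + 4, impossible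
    have f := floor_shift (c := 4) hn (show 7 * v = 7 * v' + 1 * g + 4 * n by omega)
    rw [hk, hk'] at f
    have f' := Nat.mul_le_mul_left n f
    have e' : n * (k' + 4) = n * k' + 4 * n := by ring
    refine ⟨?_, ?_, ?_, ?_⟩ <;> intro h <;> omega
  · -- s = 3, v′ = v + 2g: K′ ≥ K + 2
    have f := floor_shift (c := 2) hn (show 7 * v' = 7 * v + 4 * g + 2 * n by omega)
    rw [hk, hk'] at f
    have f' := Nat.mul_le_mul_left n f
    have e' : n * (k + 2) = n * k + 2 * n := by ring
    refine ⟨?_, ?_, ?_, ?_⟩ <;> intro h <;> omega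
  · -- s = 4, v = v′ + 4g: K ≥ K′ + 5, impossible
    have f := floor_shift (c := 5) hn (show 7 * v = 7 * v' + 3 * g + 5 * n by omega)
    rw [hk, hk'] at f
    have f' := Nat.mul_le_mul_left n f
    have e' : n * (k' + 5) = n * k' + 5 * n := by ring
    refine ⟨?_, ?_, ?_, ?_⟩ <;> intro h <;> omega
  · -- s = 4, v′ = v + g: K′ ≥ K + 1
    have f := floor_shift (c := 1) hn (show 7 * v' = 7 * v + 2 * g + 1 * n by omega)
    rw [hk, hk'] at f
    have f' := Nat.mul_le_mul_left n f
    have e' : n * (k + 1) = n * k + 1 * n := by ring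
    refine ⟨?_, ?_, ?_, ?_⟩ <;> intro h <;> omega

/-- **The residual (Z1, Z1) case of PROPOSITION L7 — "left open" in `tables/DPRIME-THEOREM.md` §3 when `3 ∣ n`, PROPOSITION
L7 (c) of `tables/KR-FREE.md` when `3 ∤ n` — for EVERY `n`** (`7 ∤ n`; no parity, squarefreeness or joint-primitivity hypothesis,
no certificate, no character argument): two triples `T = (7y, x₂, x₃)`, `T′ = (7y′, x₂′, x₃′)` of pattern Z1 at 7 with
`n = 5·gcd(y − y′, n)` never have the same CM type at level `7n`. -/
theorem z1z1_seven_five (n y x₂ x₃ y' x₂' x₃' : ℕ) (h7n : ¬ 7 ∣ n) (hn : 0 < n)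
    (hs : 7 * n ∣ 7 * y + x₂ + x₃) (hx₂ : ¬ 7 ∣ x₂) (hx₃ : ¬ 7 ∣ x₃)
    (hs' : 7 * n ∣ 7 * y' + x₂' + x₃') (hx₂' : ¬ 7 ∣ x₂') (hx₃' : ¬ 7 ∣ x₃')
    (hn5 : n = 5 * Nat.gcd (y + (n - 1) * y') n)
    (hH : SameType (7 * n) (7 * y, x₂, x₃) (7 * y', x₂', x₃')) : False := by
  have hp : (7).Prime := by norm_num
  have hco : Nat.Coprime 7 n := (Nat.Prime.coprime_iff_not_dvd hp).mpr h7n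
  have c1 : Nat.Coprime 1 n := Nat.coprime_one_left n
  have c49 : Nat.Coprime 49 n := by simpa using Nat.Coprime.pow_left 2 hco
  have c343 : Nat.Coprime 343 n := by simpa using Nat.Coprime.pow_left 3 hco
  have m1 : 7 * 1 ≡ 7 [MOD n] := by norm_num [Nat.ModEq]
  have m2 : 7 * 7 ≡ 49 [MOD n] := by norm_num [Nat.ModEq]
  have m3 : 7 * 49 ≡ 343 [MOD n] := by norm_num [Nat.ModEq]
  -- |R_i − R_j| ≤ n, |R′_i − R′_j| ≤ n on {1, 7, 49, 343}
  have hsn := dvd_of_level hs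
  have hsn' := dvd_of_level hs'
  have d01 := delta_le n (7 * y) x₂ x₃ 1 7 hn hsn c1 hco
  have d02 := delta_le n (7 * y) x₂ x₃ 1 49 hn hsn c1 c49
  have d03 := delta_le n (7 * y) x₂ x₃ 1 343 hn hsn c1 c343
  have d12 := delta_le n (7 * y) x₂ x₃ 7 49 hn hsn hco c49
  have d13 := delta_le n (7 * y) x₂ x₃ 7 343 hn hsn hco c343
  have d23 := delta_le n (7 * y) x₂ x₃ 49 343 hn hsn c49 c343
  have d01' := delta_le n (7 * y') x₂' x₃' 1 7 hn hsn' c1 hco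
  have d02' := delta_le n (7 * y') x₂' x₃' 1 49 hn hsn' c1 c49
  have d03' := delta_le n (7 * y') x₂' x₃' 1 343 hn hsn' c1 c343
  have d12' := delta_le n (7 * y') x₂' x₃' 7 49 hn hsn' hco c49
  have d13' := delta_le n (7 * y') x₂' x₃' 7 343 hn hsn' hco c343
  have d23' := delta_le n (7 * y') x₂' x₃' 49 343 hn hsn' c49 c343
  -- the class s₁ = s(7) of z = y − y′ and its chain
  obtain ⟨g, hg⟩ : ∃ g, Nat.gcd (y + (n - 1) * y') n = g := ⟨_, rfl⟩
  have hg0 : 0 < g := hg ▸ Nat.gcd_pos_of_pos_right _ hn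
  obtain ⟨s, hs4, hv1⟩ := val_cases_q5 n (y + (n - 1) * y') 7 hn hn5 hco
  rw [hg] at hv1 hn5
  have P := fun (t₀ t₁ s : ℕ) (ht₀ : Nat.Coprime t₀ n) (ht₁u : Nat.Coprime t₁ n) (ht₁ : 7 * t₁ ≡ t₀ [MOD n])
      (hsv : s = 1 ∨ s = 2 ∨ s = 3 ∨ s = 4) (hzv : t₀ * (y + (n - 1) * y') % n = g * s) =>
    pointwise_z1z1_five h7n hn hs hx₂ hx₃ hs' hx₂' hx₃' hH ht₀ ht₁u ht₁ hn5 hsv hzv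
  rcases hs4 with rfl | rfl | rfl | rfl
  · -- classes 1, 2, 4 at 7, 49, 343
    have hv2 := val_mul7 (show (49 : ℕ) = 7 * 7 by norm_num) hv1 (show 7 * (g * 1) = n * 1 + g * 2 by omega) (by omega)
    have hv3 := val_mul7 (show (343 : ℕ) = 7 * 49 by norm_num) hv2 (show 7 * (g * 2) = n * 2 + g * 4 by omega) (by omega)
    obtain ⟨a1, -, -, -⟩ := P 7 1 1 hco c1 m1 (by norm_num) hv1
    obtain ⟨-, a2, -, -⟩ := P 49 7 2 c49 hco m2 (by norm_num) hv2
    obtain ⟨-, -, -, a3⟩ := P 343 49 4 c343 c49 m3 (by norm_num) hv3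
    have b1 := a1 rfl; have b2 := a2 rfl; have b3 := a3 rfl
    omega
  · -- classes 2, 4, 3
    have hv2 := val_mul7 (show (49 : ℕ) = 7 * 7 by norm_num) hv1 (show 7 * (g * 2) = n * 2 + g * 4 by omega) (by omega)
    have hv3 := val_mul7 (show (343 : ℕ) = 7 * 49 by norm_num) hv2 (show 7 * (g * 4) = n * 5 + g * 3 by omega) (by omega)
    obtain ⟨-, a1, -, -⟩ := P 7 1 2 hco c1 m1 (by norm_num) hv1
    obtain ⟨-, -, -, a2⟩ := P 49 7 4 c49 hco m2 (by norm_num) hv2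
    obtain ⟨-, -, a3, -⟩ := P 343 49 3 c343 c49 m3 (by norm_num) hv3
    have b1 := a1 rfl; have b2 := a2 rfl; have b3 := a3 rfl
    omega
  · -- classes 3, 1, 2
    have hv2 := val_mul7 (show (49 : ℕ) = 7 * 7 by norm_num) hv1 (show 7 * (g * 3) = n * 4 + g * 1 by omega) (by omega)
    have hv3 := val_mul7 (show (343 : ℕ) = 7 * 49 by norm_num) hv2 (show 7 * (g * 1) = n * 1 + g * 2 by omega) (by omega)
    obtain ⟨-, -, a1, -⟩ := P 7 1 3 hco c1 m1 (by norm_num) hv1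
    obtain ⟨a2, -, -, -⟩ := P 49 7 1 c49 hco m2 (by norm_num) hv2
    obtain ⟨-, a3, -, -⟩ := P 343 49 2 c343 c49 m3 (by norm_num) hv3
    have b1 := a1 rfl; have b2 := a2 rfl; have b3 := a3 rfl
    omega
  · -- classes 4, 3, 1
    have hv2 := val_mul7 (show (49 : ℕ) = 7 * 7 by norm_num) hv1 (show 7 * (g * 4) = n * 5 + g * 3 by omega) (by omega)
    have hv3 := val_mul7 (show (343 : ℕ) = 7 * 49 by norm_num) hv2 (show 7 * (g * 3) = n * 4 + g * 1 by omega) (by omega)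
    obtain ⟨-, -, -, a1⟩ := P 7 1 4 hco c1 m1 (by norm_num) hv1
    obtain ⟨-, -, a2, -⟩ := P 49 7 3 c49 hco m2 (by norm_num) hv2
    obtain ⟨a3, -, -, -⟩ := P 343 49 1 c343 c49 m3 (by norm_num) hv3
    have b1 := a1 rfl; have b2 := a2 rfl; have b3 := a3 rfl
    omega

/-- **THEOREM L, row (Z1, Z1) at p = 7 — FINAL FORM: `7y ≡ 7y′ (mod 7n)`.**  For every odd `n` with `7 ∤ n` (`3 ∣ n` allowed,
squarefree or not, no joint primitivity), two triples `T = (7y, x₂, x₃)`, `T′ = (7y′, x₂′, x₃′)` of pattern Z1 at 7 with the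
same CM type at level `7n` have `y ≡ y′ (mod n)`.  (PROPOSITION L7 (b) + (c) at every odd level; the case "left open" in
DPRIME §3 does not occur.) -/
theorem z1z1_seven (n y x₂ x₃ y' x₂' x₃' : ℕ) (h7n : ¬ 7 ∣ n) (hn : 0 < n) (hodd : Odd n)
    (hs : 7 * n ∣ 7 * y + x₂ + x₃) (hx₂ : ¬ 7 ∣ x₂) (hx₃ : ¬ 7 ∣ x₃)
    (hs' : 7 * n ∣ 7 * y' + x₂' + x₃') (hx₂' : ¬ 7 ∣ x₂') (hx₃' : ¬ 7 ∣ x₃')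
    (hH : SameType (7 * n) (7 * y, x₂, x₃) (7 * y', x₂', x₃')) : y ≡ y' [MOD n] := by
  by_contra hyy'
  exact z1z1_seven_five n y x₂ x₃ y' x₂' x₃' h7n hn hs hx₂ hx₃ hs' hx₂' hx₃'
    (SevenThree.row_Z1Z1_seven n y x₂ x₃ y' x₂' x₃' h7n hn hodd hs hx₂ hx₃ hs' hx₂' hx₃' hyy' hH) hH

end HodgeFermat.KRFree.SevenFive
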